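import Summits.ValiantsHypothesis.ValiantsHypothesis.Theorems.KPlusLogSqLawStaticPathSilentCrossings

/-!
# Route «KPlusLogSqLaw» — parametric max-weight independent set on a path: THE SILENT-CROSSING TEST, II (uniqueness of the changing index; the event step read at the crossing)

HONEST FRAMING.  Helper toward the crux `WeakLifting` (item `stmt-ValiantsHypothesis-19561`, route `KPlusLogSqLaw`, cell `pub-symmetroid`,
seat val-sym-lift-p4 g24, 2026-08-29) on the line of its witness-plan stub `stub_tridiagonalSectorB` (tropical twin of the STATIC tridiagonal
sector = parametric maximum-weight independent set on a path; located theory `HOME/val-sym-lift-p4/SILENT-FLIP-LAW.md` (F1), (F4)).  Sequel of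
`…StaticPathGapChargingSweep` (`event_iff_records`) and `…StaticPathSweepChain` (one crossing between two cuts).  The silent-flip law
`…StaticPathSilentFlipsSweep` counts «record changes» at the sample points of a discrete sweep; to package it per CROSSING of an explicit instance
(as `sweep_count_eq` does for events) one needs the local dictionary proved here.  Setting of `ne_across_eventCrossing`: the crossing `τ` of the
non-parallel pair `(α, κ)`, `α < κ ≤ n`, two cuts `cm < τ < cp` with no other crossing abscissa in between, parallel pairs distinct lines; `u`, `s`
the midpoints of `(cm, τ)`, `(τ, cp)`.  Then:
* `recordChange_iff_silentTest` — SOME index `z ≤ n` changes its record status (left touch or right touch) between `u` and `s` iff THE SILENT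
  TEST holds AT `τ` — part I (`…StaticPathSilentCrossings`); here:
* `recordChange_unique` — at most ONE index changes (it is `κ` in the first case, `α` in the second);
* `stepHyps_of_cuts` — the per-step hypotheses (other pairs keep order, distinct values at `u`/`s`, adjacency at `u`, the pair flips) of the
  discrete-sweep theorems hold across one crossing between two cuts;
* `eventStep_iff_eventTest` — the chain-form event at `u` (α left record, κ right record, no record strictly between) iff the event test of
  `…StaticPathSweep` at `τ` (`lab (κ-1) τ = α ∧ κ right record at τ`).
Statements about a path DP; nothing here asserts anything about `WeakLifting`, `TropicalB`, `KPlusLogSqLaw`, the stub in its window,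
`MatrixDescartes` (stmt-ValiantsHypothesis-18050) or `VP ≠ VNP`.
-/

set_option linter.dupNamespace false
set_option autoImplicit false

namespace Summit.ValiantsHypothesis.ValiantsHypothesis.Theorems.KPlusLogSqLaw

open Finset Classical

namespace StaticPathFold

noncomputable section

section SilentCrossingsMore

variable (w₁ w₀ : ℕ → ℝ)

/-- **AT MOST ONE INDEX CHANGES ITS RECORD STATUS ACROSS A CROSSING** (so the silent flips of a sweep are counted by crossings). [folklore] -/
theorem recordChange_unique {i n α κ : ℕ} (hακ : α < κ) (hκn : κ ≤ n) (hA : altA (shift i w₁) α ≠ altA (shift i w₁) κ)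
    {cm cp : ℝ}
    (hcm : cm < (altB (shift i w₀) κ - altB (shift i w₀) α) / (altA (shift i w₁) α - altA (shift i w₁) κ))
    (hcp : (altB (shift i w₀) κ - altB (shift i w₀) α) / (altA (shift i w₁) α - altA (shift i w₁) κ) < cp)
    (hpar : ∀ p q, p < q → q ≤ n → altA (shift i w₁) p = altA (shift i w₁) q → altB (shift i w₀) p ≠ altB (shift i w₀) q)
    (hcut : ∀ p q, p < q → q ≤ n → altA (shift i w₁) p ≠ altA (shift i w₁) q → (p ≠ α ∨ q ≠ κ) →
      (altB (shift i w₀) q - altB (shift i w₀) p) / (altA (shift i w₁) p - altA (shift i w₁) q) ≤ cm ∨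
        cp ≤ (altB (shift i w₀) q - altB (shift i w₀) p) / (altA (shift i w₁) p - altA (shift i w₁) q))
    {z z' : ℕ} (hzn : z ≤ n) (hz'n : z' ≤ n)
    (hz : ¬ ((fold (altA (shift i w₁)) (altB (shift i w₀)) z ((cm + (altB (shift i w₀) κ - altB (shift i w₀) α) / (altA (shift i w₁) α - altA (shift i w₁) κ)) / 2) = L (altA (shift i w₁)) (altB (shift i w₀)) z ((cm + (altB (shift i w₀) κ - altB (shift i w₀) α) / (altA (shift i w₁) α - altA (shift i w₁) κ)) / 2) ∨
            fold (altA (shift 0 (rev i n w₁))) (altB (shift 0 (rev i n w₀))) (n - z) ((cm + (altB (shift i w₀) κ - altB (shift i w₀) α) / (altA (shift i w₁) α - altA (shift i w₁) κ)) / 2) =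
              L (altA (shift 0 (rev i n w₁))) (altB (shift 0 (rev i n w₀))) (n - z) ((cm + (altB (shift i w₀) κ - altB (shift i w₀) α) / (altA (shift i w₁) α - altA (shift i w₁) κ)) / 2)) ↔
          (fold (altA (shift i w₁)) (altB (shift i w₀)) z (((altB (shift i w₀) κ - altB (shift i w₀) α) / (altA (shift i w₁) α - altA (shift i w₁) κ) + cp) / 2) = L (altA (shift i w₁)) (altB (shift i w₀)) z (((altB (shift i w₀) κ - altB (shift i w₀) α) / (altA (shift i w₁) α - altA (shift i w₁) κ) + cp) / 2) ∨
            fold (altA (shift 0 (rev i n w₁))) (altB (shift 0 (rev i n w₀))) (n - z) (((altB (shift i w₀) κ - altB (shift i w₀) α) / (altA (shift i w₁) α - altA (shift i w₁) κ) + cp) / 2) =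
              L (altA (shift 0 (rev i n w₁))) (altB (shift 0 (rev i n w₀))) (n - z) (((altB (shift i w₀) κ - altB (shift i w₀) α) / (altA (shift i w₁) α - altA (shift i w₁) κ) + cp) / 2))))
    (hz' : ¬ ((fold (altA (shift i w₁)) (altB (shift i w₀)) z' ((cm + (altB (shift i w₀) κ - altB (shift i w₀) α) / (altA (shift i w₁) α - altA (shift i w₁) κ)) / 2) = L (altA (shift i w₁)) (altB (shift i w₀)) z' ((cm + (altB (shift i w₀) κ - altB (shift i w₀) α) / (altA (shift i w₁) α - altA (shift i w₁) κ)) / 2) ∨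
            fold (altA (shift 0 (rev i n w₁))) (altB (shift 0 (rev i n w₀))) (n - z') ((cm + (altB (shift i w₀) κ - altB (shift i w₀) α) / (altA (shift i w₁) α - altA (shift i w₁) κ)) / 2) =
              L (altA (shift 0 (rev i n w₁))) (altB (shift 0 (rev i n w₀))) (n - z') ((cm + (altB (shift i w₀) κ - altB (shift i w₀) α) / (altA (shift i w₁) α - altA (shift i w₁) κ)) / 2)) ↔
          (fold (altA (shift i w₁)) (altB (shift i w₀)) z' (((altB (shift i w₀) κ - altB (shift i w₀) α) / (altA (shift i w₁) α - altA (shift i w₁) κ) + cp) / 2) = L (altA (shift i w₁)) (altB (shift i w₀)) z' (((altB (shift i w₀) κ - altB (shift i w₀) α) / (altA (shift i w₁) α - altA (shift i w₁) κ) + cp) / 2) ∨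
            fold (altA (shift 0 (rev i n w₁))) (altB (shift 0 (rev i n w₀))) (n - z') (((altB (shift i w₀) κ - altB (shift i w₀) α) / (altA (shift i w₁) α - altA (shift i w₁) κ) + cp) / 2) =
              L (altA (shift 0 (rev i n w₁))) (altB (shift 0 (rev i n w₀))) (n - z') (((altB (shift i w₀) κ - altB (shift i w₀) α) / (altA (shift i w₁) α - altA (shift i w₁) κ) + cp) / 2)))) :
    z = z' := by
  set A := altA (shift i w₁) with hAdef
  set B := altB (shift i w₀) with hBdef
  set A' := altA (shift 0 (rev i n w₁)) with hA'def
  set B' := altB (shift 0 (rev i n w₀)) with hB'def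
  set τ := (B κ - B α) / (A α - A κ) with hτ
  set u := (cm + τ) / 2 with hu
  set s := (τ + cp) / 2 with hs
  have hαn : α ≤ n := hακ.le.trans hκn
  have hu1 : cm < u := by rw [hu]; linarith
  have hu2 : u < τ := by rw [hu]; linarith
  have hs1 : τ < s := by rw [hs]; linarith
  have hs2 : s < cp := by rw [hs]; linarith
  -- other pairs keep their order on `[u, s]` (in particular at `τ` and at `s`)
  have hkeep : ∀ (t : ℝ), u ≤ t → t ≤ s → ∀ p q, p ≤ n → q ≤ n → ¬(p = α ∧ q = κ) → ¬(p = κ ∧ q = α) →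
      (L A B p u < L A B q u ↔ L A B p t < L A B q t) := by
    intro t hut hts p q hp hq h1 h2
    by_cases hApq : A p = A q
    · exact L_lt_iff_of_parallel A B hApq u t
    rcases lt_trichotomy p q with hpq | rfl | hpq
    · rcases hcut p q hpq hq hApq (by by_contra hh; push Not at hh; exact h1 hh) with h | h
      · exact L_lt_iff_of_notMem A B hApq hut (Or.inl (lt_of_le_of_lt h hu1))
      · exact L_lt_iff_of_notMem A B hApq hut (Or.inr (lt_of_lt_of_le (lt_of_le_of_lt hts hs2) h))
    · exact absurd rfl hApq
    · rcases hcut q p hpq hp (Ne.symm hApq) (by by_contra hh; push Not at hh; exact h2 ⟨hh.2, hh.1⟩) with h | h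
      · rw [crossing_symm A B] at h
        exact L_lt_iff_of_notMem A B hApq hut (Or.inl (lt_of_le_of_lt h hu1))
      · rw [crossing_symm A B] at h
        exact L_lt_iff_of_notMem A B hApq hut (Or.inr (lt_of_lt_of_le (lt_of_le_of_lt hts hs2) h))
  have hord_us : ∀ p q, p ≤ n → q ≤ n → ¬(p = α ∧ q = κ) → ¬(p = κ ∧ q = α) → (L A B p u < L A B q u ↔ L A B p s < L A B q s) :=
    fun p q hp hq h1 h2 => hkeep s (hu2.trans hs1).le le_rfl p q hp hq h1 h2
  have hord_uτ : ∀ p q, p ≤ n → q ≤ n → ¬(p = α ∧ q = κ) → ¬(p = κ ∧ q = α) → (L A B p u < L A B q u ↔ L A B p τ < L A B q τ) :=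
    fun p q hp hq h1 h2 => hkeep τ hu2.le hs1.le p q hp hq h1 h2
  -- distinct values at `u` and at `s`
  have hnc : ∀ (t : ℝ), cm < t → t < cp → t ≠ τ → ∀ p q, p < q → q ≤ n → A p ≠ A q → (B q - B p) / (A p - A q) ≠ t := by
    intro t ht1 ht2 htτ p q hpq hqn hApq he
    by_cases hpqακ : p = α ∧ q = κ
    · obtain ⟨rfl, rfl⟩ := hpqακ
      exact htτ he.symm
    · rcases hcut p q hpq hqn hApq (by by_contra hh; push Not at hh; exact hpqακ hh) with h | h
      · linarith
      · linarith
  have hdisu := distinct_of_no_crossing_at w₁ w₀ (n := n) hpar (hnc u hu1 (hu2.trans (hs1.trans hs2)) (ne_of_lt hu2))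
  have hdiss := distinct_of_no_crossing_at w₁ w₀ (n := n) hpar (hnc s (hu1.trans (hu2.trans hs1)) hs2 (ne_of_gt hs1))
  have hadj : ∀ x, x ≤ n → x ≠ α → x ≠ κ → (L A B x u < L A B α u ↔ L A B x u < L A B κ u) := by
    intro x hx hxα hxκ
    have e1 := hkeep τ hu2.le hs1.le x α hx hαn (fun h => hxα h.1) (fun h => hxκ h.1)
    have e2 := hkeep τ hu2.le hs1.le x κ hx hκn (fun h => hxα h.1) (fun h => hxκ h.1)
    rw [e1, e2, show L A B α τ = L A B κ τ from L_eq_at_crossing A B hA]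
  -- transfers between `u`, `s` and `τ` of the four tie-free quantities
  have hlab_uτ : lab A B (κ - 1) u = lab A B (κ - 1) τ :=
    lab_eq_of_order A B (n := κ - 1) (fun p q hp hq => hord_uτ p q (by omega) (by omega) (fun h => by omega) (fun h => by omega))
      (κ - 1) le_rfl
  have hlab_us : lab A B (κ - 1) u = lab A B (κ - 1) s :=
    lab_eq_of_order A B (n := κ - 1) (fun p q hp hq => hord_us p q (by omega) (by omega) (fun h => by omega) (fun h => by omega))
      (κ - 1) le_rfl
  have hR_uτ : (fold A' B' (n - κ) u = L A' B' (n - κ) u ↔ fold A' B' (n - κ) τ = L A' B' (n - κ) τ) :=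
    fold_eq_L_iff_of_order A' B' (n := n - κ)
      (rev_order_of_order_ge w₁ w₀ hκn (fun p q hp hpn hq hqn => hord_uτ p q hpn hqn (fun h => by omega) (fun h => by omega)))
      (k := n - κ) le_rfl
  have hR_us : (fold A' B' (n - κ) u = L A' B' (n - κ) u ↔ fold A' B' (n - κ) s = L A' B' (n - κ) s) :=
    fold_eq_L_iff_of_order A' B' (n := n - κ)
      (rev_order_of_order_ge w₁ w₀ hκn (fun p q hp hpn hq hqn => hord_us p q hpn hqn (fun h => by omega) (fun h => by omega)))
      (k := n - κ) le_rfl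
  have hlab'_uτ : lab A' B' (n - α - 1) u = lab A' B' (n - α - 1) τ :=
    lab_eq_of_order A' B' (n := n - α - 1)
      (fun y z hy hz => rev_order_of_order_ge w₁ w₀ (k := α + 1) (by omega)
        (fun p q hp hpn hq hqn => hord_uτ p q hpn hqn (fun h => by omega) (fun h => by omega)) y z (by omega) (by omega))
      (n - α - 1) le_rfl
  have hlab'_us : lab A' B' (n - α - 1) u = lab A' B' (n - α - 1) s :=
    lab_eq_of_order A' B' (n := n - α - 1)
      (fun y z hy hz => rev_order_of_order_ge w₁ w₀ (k := α + 1) (by omega)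
        (fun p q hp hpn hq hqn => hord_us p q hpn hqn (fun h => by omega) (fun h => by omega)) y z (by omega) (by omega))
      (n - α - 1) le_rfl
  have hL_uτ : (fold A B α u = L A B α u ↔ fold A B α τ = L A B α τ) :=
    fold_eq_L_iff_of_order A B (n := α) (fun p q hp hq => hord_uτ p q (by omega) (by omega) (fun h => by omega) (fun h => by omega))
      (k := α) le_rfl
  have hL_us : (fold A B α u = L A B α u ↔ fold A B α s = L A B α s) :=
    fold_eq_L_iff_of_order A B (n := α) (fun p q hp hq => hord_us p q (by omega) (by omega) (fun h => by omega) (fun h => by omega))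
      (k := α) le_rfl
  -- hypotheses for the reversed family across `u`, `s`
  have hord' := rev_ord_of_ord w₁ w₀ hαn hκn hord_us
  have hdisRu := rev_ne_of_ne w₁ w₀ (n := n) hdisu
  have hdisRs := rev_ne_of_ne w₁ w₀ (n := n) hdiss
  have hadj' := rev_adj_of_adj w₁ w₀ hαn hκn hdisu hadj
  -- the pair flips between `u` and `s`, in both families
  have hflip : L A B α u < L A B κ u ↔ ¬ L A B α s < L A B κ s := L_lt_flip_of_mem A B hA hu2 hs1
  have hflip' : L A' B' (n - κ) u < L A' B' (n - α) u ↔ ¬ L A' B' (n - κ) s < L A' B' (n - α) s := by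
    rw [rev_lt_iff w₁ w₀ (Nat.sub_le n κ) (Nat.sub_le n α), rev_lt_iff w₁ w₀ (Nat.sub_le n κ) (Nat.sub_le n α),
      show n - (n - α) = α by omega, show n - (n - κ) = κ by omega]
    have hflip2 : L A B κ u < L A B α u ↔ ¬ L A B κ s < L A B α s := by
      have e1 : L A B κ u < L A B α u ↔ ¬ L A B α u < L A B κ u :=
        ⟨fun h h' => lt_asymm h h', fun h => lt_of_le_of_ne (not_lt.mp h) (hdisu κ α hκn hαn (by omega))⟩
      have e2 : L A B κ s < L A B α s ↔ ¬ L A B α s < L A B κ s :=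
        ⟨fun h h' => lt_asymm h h', fun h => lt_of_le_of_ne (not_lt.mp h) (hdiss κ α hκn hαn (by omega))⟩
      rw [e1, e2, hflip, not_not]
    rcases neg_one_pow_eq_or ℝ (n + 1) with h | h
    · rw [h, one_mul, one_mul, one_mul, one_mul]; exact hflip
    · rw [h, neg_one_mul, neg_one_mul, neg_one_mul, neg_one_mul, neg_lt_neg_iff, neg_lt_neg_iff]; exact hflip2
  -- status of every index other than `α`, `κ` is unchanged
  have hLz : ∀ z, z ≤ n → z ≠ κ → (fold A B z u = L A B z u ↔ fold A B z s = L A B z s) := fun z hz hzκ =>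
    touch_iff_of_transposition hακ hκn hord_us hdisu hdiss hadj hz hzκ
  have hRz : ∀ z, z ≤ n → z ≠ α → (fold A' B' (n - z) u = L A' B' (n - z) u ↔ fold A' B' (n - z) s = L A' B' (n - z) s) :=
    fun z hz hzα => touch_iff_of_transposition (show n - κ < n - α by omega) (Nat.sub_le n α) hord' hdisRu hdisRs hadj'
      (Nat.sub_le n z) (by omega)
  -- a changing index is `κ` (and then `α` is a left record at `u`) or `α` (and then `α` is NOT a left record at `u`)
  have key : ∀ w, w ≤ n → ¬ ((fold A B w u = L A B w u ∨ fold A' B' (n - w) u = L A' B' (n - w) u) ↔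
      (fold A B w s = L A B w s ∨ fold A' B' (n - w) s = L A' B' (n - w) s)) →
      (w = κ ∧ fold A B α u = L A B α u) ∨ (w = α ∧ ¬ fold A B α u = L A B α u) := by
    intro w hwn hch
    by_cases hwκ : w = κ
    · subst hwκ
      left
      have hR := hRz w hwn (by omega)
      have hLch : ¬ (fold A B w u = L A B w u ↔ fold A B w s = L A B w s) := by
        intro h
        apply hch
        rw [h]
        exact or_congr_right hR
      have hlab : lab A B (w - 1) u = α := by
        by_contra hne
        exact hLch (touch_larger_iff_of_ne hακ hκn hord_us hne)
      exact ⟨rfl, fold_eq_of_lab_eq A B hlab⟩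
    · by_cases hwα : w = α
      · subst hwα
        right
        have hL := hLz w hwn (by omega)
        exact ⟨rfl, fun h => hch (iff_of_true (Or.inl h) (Or.inl (hL.mp h)))⟩
      · exact absurd (or_congr (hLz w hwn hwκ) (hRz w hwn hwα)) hch
  rcases key z hzn hz with ⟨h1, h2⟩ | ⟨h1, h2⟩ <;> rcases key z' hz'n hz' with ⟨h1', h2'⟩ | ⟨h1', h2'⟩
  exacts [by rw [h1, h1'], absurd h2 h2', absurd h2' h2, by rw [h1, h1']]

/-- **THE EVENT STEP READ AT THE CROSSING**: the chain-form event at the sample point `u` before the crossing (α left record, κ right record, no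
record strictly between) iff the event test of `…StaticPathSweep` at `τ` (`α` the active index below `κ`, `κ` a right record). [folklore] -/
theorem eventStep_iff_eventTest {i n α κ : ℕ} (hακ : α < κ) (hκn : κ ≤ n) (hA : altA (shift i w₁) α ≠ altA (shift i w₁) κ)
    {cm cp : ℝ}
    (hcm : cm < (altB (shift i w₀) κ - altB (shift i w₀) α) / (altA (shift i w₁) α - altA (shift i w₁) κ))
    (hcp : (altB (shift i w₀) κ - altB (shift i w₀) α) / (altA (shift i w₁) α - altA (shift i w₁) κ) < cp)
    (hpar : ∀ p q, p < q → q ≤ n → altA (shift i w₁) p = altA (shift i w₁) q → altB (shift i w₀) p ≠ altB (shift i w₀) q)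
    (hcut : ∀ p q, p < q → q ≤ n → altA (shift i w₁) p ≠ altA (shift i w₁) q → (p ≠ α ∨ q ≠ κ) →
      (altB (shift i w₀) q - altB (shift i w₀) p) / (altA (shift i w₁) p - altA (shift i w₁) q) ≤ cm ∨
        cp ≤ (altB (shift i w₀) q - altB (shift i w₀) p) / (altA (shift i w₁) p - altA (shift i w₁) q))  :
    (fold (altA (shift i w₁)) (altB (shift i w₀)) α ((cm + (altB (shift i w₀) κ - altB (shift i w₀) α) / (altA (shift i w₁) α - altA (shift i w₁) κ)) / 2) = L (altA (shift i w₁)) (altB (shift i w₀)) α ((cm + (altB (shift i w₀) κ - altB (shift i w₀) α) / (altA (shift i w₁) α - altA (shift i w₁) κ)) / 2) ∧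
        fold (altA (shift 0 (rev i n w₁))) (altB (shift 0 (rev i n w₀))) (n - κ) ((cm + (altB (shift i w₀) κ - altB (shift i w₀) α) / (altA (shift i w₁) α - altA (shift i w₁) κ)) / 2) =
          L (altA (shift 0 (rev i n w₁))) (altB (shift 0 (rev i n w₀))) (n - κ) ((cm + (altB (shift i w₀) κ - altB (shift i w₀) α) / (altA (shift i w₁) α - altA (shift i w₁) κ)) / 2) ∧
        ∀ z, α < z → z < κ →
          ¬ fold (altA (shift i w₁)) (altB (shift i w₀)) z ((cm + (altB (shift i w₀) κ - altB (shift i w₀) α) / (altA (shift i w₁) α - altA (shift i w₁) κ)) / 2) = L (altA (shift i w₁)) (altB (shift i w₀)) z ((cm + (altB (shift i w₀) κ - altB (shift i w₀) α) / (altA (shift i w₁) α - altA (shift i w₁) κ)) / 2) ∧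
            ¬ fold (altA (shift 0 (rev i n w₁))) (altB (shift 0 (rev i n w₀))) (n - z) ((cm + (altB (shift i w₀) κ - altB (shift i w₀) α) / (altA (shift i w₁) α - altA (shift i w₁) κ)) / 2) =
              L (altA (shift 0 (rev i n w₁))) (altB (shift 0 (rev i n w₀))) (n - z) ((cm + (altB (shift i w₀) κ - altB (shift i w₀) α) / (altA (shift i w₁) α - altA (shift i w₁) κ)) / 2)) ↔
      (lab (altA (shift i w₁)) (altB (shift i w₀)) (κ - 1) ((altB (shift i w₀) κ - altB (shift i w₀) α) / (altA (shift i w₁) α - altA (shift i w₁) κ)) = α ∧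
        fold (altA (shift 0 (rev i n w₁))) (altB (shift 0 (rev i n w₀))) (n - κ) ((altB (shift i w₀) κ - altB (shift i w₀) α) / (altA (shift i w₁) α - altA (shift i w₁) κ)) =
          L (altA (shift 0 (rev i n w₁))) (altB (shift 0 (rev i n w₀))) (n - κ) ((altB (shift i w₀) κ - altB (shift i w₀) α) / (altA (shift i w₁) α - altA (shift i w₁) κ))) := by
  set A := altA (shift i w₁) with hAdef
  set B := altB (shift i w₀) with hBdef
  set A' := altA (shift 0 (rev i n w₁)) with hA'def
  set B' := altB (shift 0 (rev i n w₀)) with hB'def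
  set τ := (B κ - B α) / (A α - A κ) with hτ
  set u := (cm + τ) / 2 with hu
  set s := (τ + cp) / 2 with hs
  have hαn : α ≤ n := hακ.le.trans hκn
  have hu1 : cm < u := by rw [hu]; linarith
  have hu2 : u < τ := by rw [hu]; linarith
  have hs1 : τ < s := by rw [hs]; linarith
  have hs2 : s < cp := by rw [hs]; linarith
  -- other pairs keep their order on `[u, s]` (in particular at `τ` and at `s`)
  have hkeep : ∀ (t : ℝ), u ≤ t → t ≤ s → ∀ p q, p ≤ n → q ≤ n → ¬(p = α ∧ q = κ) → ¬(p = κ ∧ q = α) →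
      (L A B p u < L A B q u ↔ L A B p t < L A B q t) := by
    intro t hut hts p q hp hq h1 h2
    by_cases hApq : A p = A q
    · exact L_lt_iff_of_parallel A B hApq u t
    rcases lt_trichotomy p q with hpq | rfl | hpq
    · rcases hcut p q hpq hq hApq (by by_contra hh; push Not at hh; exact h1 hh) with h | h
      · exact L_lt_iff_of_notMem A B hApq hut (Or.inl (lt_of_le_of_lt h hu1))
      · exact L_lt_iff_of_notMem A B hApq hut (Or.inr (lt_of_lt_of_le (lt_of_le_of_lt hts hs2) h))
    · exact absurd rfl hApq
    · rcases hcut q p hpq hp (Ne.symm hApq) (by by_contra hh; push Not at hh; exact h2 ⟨hh.2, hh.1⟩) with h | h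
      · rw [crossing_symm A B] at h
        exact L_lt_iff_of_notMem A B hApq hut (Or.inl (lt_of_le_of_lt h hu1))
      · rw [crossing_symm A B] at h
        exact L_lt_iff_of_notMem A B hApq hut (Or.inr (lt_of_lt_of_le (lt_of_le_of_lt hts hs2) h))
  have hord_us : ∀ p q, p ≤ n → q ≤ n → ¬(p = α ∧ q = κ) → ¬(p = κ ∧ q = α) → (L A B p u < L A B q u ↔ L A B p s < L A B q s) :=
    fun p q hp hq h1 h2 => hkeep s (hu2.trans hs1).le le_rfl p q hp hq h1 h2
  have hord_uτ : ∀ p q, p ≤ n → q ≤ n → ¬(p = α ∧ q = κ) → ¬(p = κ ∧ q = α) → (L A B p u < L A B q u ↔ L A B p τ < L A B q τ) :=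
    fun p q hp hq h1 h2 => hkeep τ hu2.le hs1.le p q hp hq h1 h2
  -- distinct values at `u` and at `s`
  have hnc : ∀ (t : ℝ), cm < t → t < cp → t ≠ τ → ∀ p q, p < q → q ≤ n → A p ≠ A q → (B q - B p) / (A p - A q) ≠ t := by
    intro t ht1 ht2 htτ p q hpq hqn hApq he
    by_cases hpqακ : p = α ∧ q = κ
    · obtain ⟨rfl, rfl⟩ := hpqακ
      exact htτ he.symm
    · rcases hcut p q hpq hqn hApq (by by_contra hh; push Not at hh; exact hpqακ hh) with h | h
      · linarith
      · linarith
  have hdisu := distinct_of_no_crossing_at w₁ w₀ (n := n) hpar (hnc u hu1 (hu2.trans (hs1.trans hs2)) (ne_of_lt hu2))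
  have hdiss := distinct_of_no_crossing_at w₁ w₀ (n := n) hpar (hnc s (hu1.trans (hu2.trans hs1)) hs2 (ne_of_gt hs1))
  have hadj : ∀ x, x ≤ n → x ≠ α → x ≠ κ → (L A B x u < L A B α u ↔ L A B x u < L A B κ u) := by
    intro x hx hxα hxκ
    have e1 := hkeep τ hu2.le hs1.le x α hx hαn (fun h => hxα h.1) (fun h => hxκ h.1)
    have e2 := hkeep τ hu2.le hs1.le x κ hx hκn (fun h => hxα h.1) (fun h => hxκ h.1)
    rw [e1, e2, show L A B α τ = L A B κ τ from L_eq_at_crossing A B hA]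
  -- transfers between `u`, `s` and `τ` of the four tie-free quantities
  have hlab_uτ : lab A B (κ - 1) u = lab A B (κ - 1) τ :=
    lab_eq_of_order A B (n := κ - 1) (fun p q hp hq => hord_uτ p q (by omega) (by omega) (fun h => by omega) (fun h => by omega))
      (κ - 1) le_rfl
  have hlab_us : lab A B (κ - 1) u = lab A B (κ - 1) s :=
    lab_eq_of_order A B (n := κ - 1) (fun p q hp hq => hord_us p q (by omega) (by omega) (fun h => by omega) (fun h => by omega))
      (κ - 1) le_rfl
  have hR_uτ : (fold A' B' (n - κ) u = L A' B' (n - κ) u ↔ fold A' B' (n - κ) τ = L A' B' (n - κ) τ) :=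
    fold_eq_L_iff_of_order A' B' (n := n - κ)
      (rev_order_of_order_ge w₁ w₀ hκn (fun p q hp hpn hq hqn => hord_uτ p q hpn hqn (fun h => by omega) (fun h => by omega)))
      (k := n - κ) le_rfl
  have hR_us : (fold A' B' (n - κ) u = L A' B' (n - κ) u ↔ fold A' B' (n - κ) s = L A' B' (n - κ) s) :=
    fold_eq_L_iff_of_order A' B' (n := n - κ)
      (rev_order_of_order_ge w₁ w₀ hκn (fun p q hp hpn hq hqn => hord_us p q hpn hqn (fun h => by omega) (fun h => by omega)))
      (k := n - κ) le_rfl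
  have hlab'_uτ : lab A' B' (n - α - 1) u = lab A' B' (n - α - 1) τ :=
    lab_eq_of_order A' B' (n := n - α - 1)
      (fun y z hy hz => rev_order_of_order_ge w₁ w₀ (k := α + 1) (by omega)
        (fun p q hp hpn hq hqn => hord_uτ p q hpn hqn (fun h => by omega) (fun h => by omega)) y z (by omega) (by omega))
      (n - α - 1) le_rfl
  have hlab'_us : lab A' B' (n - α - 1) u = lab A' B' (n - α - 1) s :=
    lab_eq_of_order A' B' (n := n - α - 1)
      (fun y z hy hz => rev_order_of_order_ge w₁ w₀ (k := α + 1) (by omega)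
        (fun p q hp hpn hq hqn => hord_us p q hpn hqn (fun h => by omega) (fun h => by omega)) y z (by omega) (by omega))
      (n - α - 1) le_rfl
  have hL_uτ : (fold A B α u = L A B α u ↔ fold A B α τ = L A B α τ) :=
    fold_eq_L_iff_of_order A B (n := α) (fun p q hp hq => hord_uτ p q (by omega) (by omega) (fun h => by omega) (fun h => by omega))
      (k := α) le_rfl
  have hL_us : (fold A B α u = L A B α u ↔ fold A B α s = L A B α s) :=
    fold_eq_L_iff_of_order A B (n := α) (fun p q hp hq => hord_us p q (by omega) (by omega) (fun h => by omega) (fun h => by omega))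
      (k := α) le_rfl
  -- hypotheses for the reversed family across `u`, `s`
  have hord' := rev_ord_of_ord w₁ w₀ hαn hκn hord_us
  have hdisRu := rev_ne_of_ne w₁ w₀ (n := n) hdisu
  have hdisRs := rev_ne_of_ne w₁ w₀ (n := n) hdiss
  have hadj' := rev_adj_of_adj w₁ w₀ hαn hκn hdisu hadj
  -- the pair flips between `u` and `s`, in both families
  have hflip : L A B α u < L A B κ u ↔ ¬ L A B α s < L A B κ s := L_lt_flip_of_mem A B hA hu2 hs1
  have hflip' : L A' B' (n - κ) u < L A' B' (n - α) u ↔ ¬ L A' B' (n - κ) s < L A' B' (n - α) s := by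
    rw [rev_lt_iff w₁ w₀ (Nat.sub_le n κ) (Nat.sub_le n α), rev_lt_iff w₁ w₀ (Nat.sub_le n κ) (Nat.sub_le n α),
      show n - (n - α) = α by omega, show n - (n - κ) = κ by omega]
    have hflip2 : L A B κ u < L A B α u ↔ ¬ L A B κ s < L A B α s := by
      have e1 : L A B κ u < L A B α u ↔ ¬ L A B α u < L A B κ u :=
        ⟨fun h h' => lt_asymm h h', fun h => lt_of_le_of_ne (not_lt.mp h) (hdisu κ α hκn hαn (by omega))⟩
      have e2 : L A B κ s < L A B α s ↔ ¬ L A B α s < L A B κ s :=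
        ⟨fun h h' => lt_asymm h h', fun h => lt_of_le_of_ne (not_lt.mp h) (hdiss κ α hκn hαn (by omega))⟩
      rw [e1, e2, hflip, not_not]
    rcases neg_one_pow_eq_or ℝ (n + 1) with h | h
    · rw [h, one_mul, one_mul, one_mul, one_mul]; exact hflip
    · rw [h, neg_one_mul, neg_one_mul, neg_one_mul, neg_one_mul, neg_lt_neg_iff, neg_lt_neg_iff]; exact hflip2
  -- status of every index other than `α`, `κ` is unchanged
  have hLz : ∀ z, z ≤ n → z ≠ κ → (fold A B z u = L A B z u ↔ fold A B z s = L A B z s) := fun z hz hzκ =>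
    touch_iff_of_transposition hακ hκn hord_us hdisu hdiss hadj hz hzκ
  have hRz : ∀ z, z ≤ n → z ≠ α → (fold A' B' (n - z) u = L A' B' (n - z) u ↔ fold A' B' (n - z) s = L A' B' (n - z) s) :=
    fun z hz hzα => touch_iff_of_transposition (show n - κ < n - α by omega) (Nat.sub_le n α) hord' hdisRu hdisRs hadj'
      (Nat.sub_le n z) (by omega)
  rw [← event_iff_records w₁ w₀ hακ hκn hdisu hadj, ← event_iff_of_order w₁ w₀ hακ hκn hord_uτ, lab_pred_eq_iff A B hακ u, and_assoc]

/-- **THE STEP HYPOTHESES ACROSS ONE CROSSING**: between the two midpoint samples `u`, `s` around the crossing of `(S_α, S_κ)` (cuts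
`cm < τ < cp`, no other crossing abscissa in between, parallel pairs distinct lines) every other pair keeps its order, the values are pairwise
distinct at `u` and at `s`, the pair is adjacent at `u`, and the pair reverses its order — the per-step hypotheses of the discrete sweeps of
`…StaticPathGapChargingSweep` / `…StaticPathSilentFlipsSweep`. [folklore] -/
theorem stepHyps_of_cuts {i n α κ : ℕ} (hακ : α < κ) (hκn : κ ≤ n) (hA : altA (shift i w₁) α ≠ altA (shift i w₁) κ)
    {cm cp : ℝ}
    (hcm : cm < (altB (shift i w₀) κ - altB (shift i w₀) α) / (altA (shift i w₁) α - altA (shift i w₁) κ))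
    (hcp : (altB (shift i w₀) κ - altB (shift i w₀) α) / (altA (shift i w₁) α - altA (shift i w₁) κ) < cp)
    (hpar : ∀ p q, p < q → q ≤ n → altA (shift i w₁) p = altA (shift i w₁) q → altB (shift i w₀) p ≠ altB (shift i w₀) q)
    (hcut : ∀ p q, p < q → q ≤ n → altA (shift i w₁) p ≠ altA (shift i w₁) q → (p ≠ α ∨ q ≠ κ) →
      (altB (shift i w₀) q - altB (shift i w₀) p) / (altA (shift i w₁) p - altA (shift i w₁) q) ≤ cm ∨
        cp ≤ (altB (shift i w₀) q - altB (shift i w₀) p) / (altA (shift i w₁) p - altA (shift i w₁) q)) :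
    (∀ p q, p ≤ n → q ≤ n → ¬(p = α ∧ q = κ) → ¬(p = κ ∧ q = α) →
        (L (altA (shift i w₁)) (altB (shift i w₀)) p ((cm + (altB (shift i w₀) κ - altB (shift i w₀) α) / (altA (shift i w₁) α - altA (shift i w₁) κ)) / 2) < L (altA (shift i w₁)) (altB (shift i w₀)) q ((cm + (altB (shift i w₀) κ - altB (shift i w₀) α) / (altA (shift i w₁) α - altA (shift i w₁) κ)) / 2) ↔
          L (altA (shift i w₁)) (altB (shift i w₀)) p (((altB (shift i w₀) κ - altB (shift i w₀) α) / (altA (shift i w₁) α - altA (shift i w₁) κ) + cp) / 2) < L (altA (shift i w₁)) (altB (shift i w₀)) q (((altB (shift i w₀) κ - altB (shift i w₀) α) / (altA (shift i w₁) α - altA (shift i w₁) κ) + cp) / 2))) ∧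
      (∀ p q, p ≤ n → q ≤ n → p ≠ q → L (altA (shift i w₁)) (altB (shift i w₀)) p ((cm + (altB (shift i w₀) κ - altB (shift i w₀) α) / (altA (shift i w₁) α - altA (shift i w₁) κ)) / 2) ≠ L (altA (shift i w₁)) (altB (shift i w₀)) q ((cm + (altB (shift i w₀) κ - altB (shift i w₀) α) / (altA (shift i w₁) α - altA (shift i w₁) κ)) / 2)) ∧
      (∀ p q, p ≤ n → q ≤ n → p ≠ q → L (altA (shift i w₁)) (altB (shift i w₀)) p (((altB (shift i w₀) κ - altB (shift i w₀) α) / (altA (shift i w₁) α - altA (shift i w₁) κ) + cp) / 2) ≠ L (altA (shift i w₁)) (altB (shift i w₀)) q (((altB (shift i w₀) κ - altB (shift i w₀) α) / (altA (shift i w₁) α - altA (shift i w₁) κ) + cp) / 2)) ∧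
      (∀ x, x ≤ n → x ≠ α → x ≠ κ →
        (L (altA (shift i w₁)) (altB (shift i w₀)) x ((cm + (altB (shift i w₀) κ - altB (shift i w₀) α) / (altA (shift i w₁) α - altA (shift i w₁) κ)) / 2) < L (altA (shift i w₁)) (altB (shift i w₀)) α ((cm + (altB (shift i w₀) κ - altB (shift i w₀) α) / (altA (shift i w₁) α - altA (shift i w₁) κ)) / 2) ↔
          L (altA (shift i w₁)) (altB (shift i w₀)) x ((cm + (altB (shift i w₀) κ - altB (shift i w₀) α) / (altA (shift i w₁) α - altA (shift i w₁) κ)) / 2) < L (altA (shift i w₁)) (altB (shift i w₀)) κ ((cm + (altB (shift i w₀) κ - altB (shift i w₀) α) / (altA (shift i w₁) α - altA (shift i w₁) κ)) / 2))) ∧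
      (L (altA (shift i w₁)) (altB (shift i w₀)) α ((cm + (altB (shift i w₀) κ - altB (shift i w₀) α) / (altA (shift i w₁) α - altA (shift i w₁) κ)) / 2) < L (altA (shift i w₁)) (altB (shift i w₀)) κ ((cm + (altB (shift i w₀) κ - altB (shift i w₀) α) / (altA (shift i w₁) α - altA (shift i w₁) κ)) / 2) ↔
        ¬ L (altA (shift i w₁)) (altB (shift i w₀)) α (((altB (shift i w₀) κ - altB (shift i w₀) α) / (altA (shift i w₁) α - altA (shift i w₁) κ) + cp) / 2) < L (altA (shift i w₁)) (altB (shift i w₀)) κ (((altB (shift i w₀) κ - altB (shift i w₀) α) / (altA (shift i w₁) α - altA (shift i w₁) κ) + cp) / 2)) := by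
  set A := altA (shift i w₁) with hAdef
  set B := altB (shift i w₀) with hBdef
  set A' := altA (shift 0 (rev i n w₁)) with hA'def
  set B' := altB (shift 0 (rev i n w₀)) with hB'def
  set τ := (B κ - B α) / (A α - A κ) with hτ
  set u := (cm + τ) / 2 with hu
  set s := (τ + cp) / 2 with hs
  have hαn : α ≤ n := hακ.le.trans hκn
  have hu1 : cm < u := by rw [hu]; linarith
  have hu2 : u < τ := by rw [hu]; linarith
  have hs1 : τ < s := by rw [hs]; linarith
  have hs2 : s < cp := by rw [hs]; linarith
  -- other pairs keep their order on `[u, s]` (in particular at `τ` and at `s`)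
  have hkeep : ∀ (t : ℝ), u ≤ t → t ≤ s → ∀ p q, p ≤ n → q ≤ n → ¬(p = α ∧ q = κ) → ¬(p = κ ∧ q = α) →
      (L A B p u < L A B q u ↔ L A B p t < L A B q t) := by
    intro t hut hts p q hp hq h1 h2
    by_cases hApq : A p = A q
    · exact L_lt_iff_of_parallel A B hApq u t
    rcases lt_trichotomy p q with hpq | rfl | hpq
    · rcases hcut p q hpq hq hApq (by by_contra hh; push Not at hh; exact h1 hh) with h | h
      · exact L_lt_iff_of_notMem A B hApq hut (Or.inl (lt_of_le_of_lt h hu1))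
      · exact L_lt_iff_of_notMem A B hApq hut (Or.inr (lt_of_lt_of_le (lt_of_le_of_lt hts hs2) h))
    · exact absurd rfl hApq
    · rcases hcut q p hpq hp (Ne.symm hApq) (by by_contra hh; push Not at hh; exact h2 ⟨hh.2, hh.1⟩) with h | h
      · rw [crossing_symm A B] at h
        exact L_lt_iff_of_notMem A B hApq hut (Or.inl (lt_of_le_of_lt h hu1))
      · rw [crossing_symm A B] at h
        exact L_lt_iff_of_notMem A B hApq hut (Or.inr (lt_of_lt_of_le (lt_of_le_of_lt hts hs2) h))
  have hord_us : ∀ p q, p ≤ n → q ≤ n → ¬(p = α ∧ q = κ) → ¬(p = κ ∧ q = α) → (L A B p u < L A B q u ↔ L A B p s < L A B q s) :=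
    fun p q hp hq h1 h2 => hkeep s (hu2.trans hs1).le le_rfl p q hp hq h1 h2
  have hord_uτ : ∀ p q, p ≤ n → q ≤ n → ¬(p = α ∧ q = κ) → ¬(p = κ ∧ q = α) → (L A B p u < L A B q u ↔ L A B p τ < L A B q τ) :=
    fun p q hp hq h1 h2 => hkeep τ hu2.le hs1.le p q hp hq h1 h2
  -- distinct values at `u` and at `s`
  have hnc : ∀ (t : ℝ), cm < t → t < cp → t ≠ τ → ∀ p q, p < q → q ≤ n → A p ≠ A q → (B q - B p) / (A p - A q) ≠ t := by
    intro t ht1 ht2 htτ p q hpq hqn hApq he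
    by_cases hpqακ : p = α ∧ q = κ
    · obtain ⟨rfl, rfl⟩ := hpqακ
      exact htτ he.symm
    · rcases hcut p q hpq hqn hApq (by by_contra hh; push Not at hh; exact hpqακ hh) with h | h
      · linarith
      · linarith
  have hdisu := distinct_of_no_crossing_at w₁ w₀ (n := n) hpar (hnc u hu1 (hu2.trans (hs1.trans hs2)) (ne_of_lt hu2))
  have hdiss := distinct_of_no_crossing_at w₁ w₀ (n := n) hpar (hnc s (hu1.trans (hu2.trans hs1)) hs2 (ne_of_gt hs1))
  have hadj : ∀ x, x ≤ n → x ≠ α → x ≠ κ → (L A B x u < L A B α u ↔ L A B x u < L A B κ u) := by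
    intro x hx hxα hxκ
    have e1 := hkeep τ hu2.le hs1.le x α hx hαn (fun h => hxα h.1) (fun h => hxκ h.1)
    have e2 := hkeep τ hu2.le hs1.le x κ hx hκn (fun h => hxα h.1) (fun h => hxκ h.1)
    rw [e1, e2, show L A B α τ = L A B κ τ from L_eq_at_crossing A B hA]
  exact ⟨hord_us, hdisu, hdiss, hadj, L_lt_flip_of_mem A B hA hu2 hs1⟩

end SilentCrossingsMore

end

end StaticPathFold

end Summit.ValiantsHypothesis.ValiantsHypothesis.Theorems.KPlusLogSqLaw
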